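import Summits.Schanuel.Schanuel.Theorems.ZilberEacDiagonalCriticalDensity
import HarnessLib

/-!
# The critical size with NON-CONSTANT fibres: `{x₂ = r₀x₀ + (1/e - r₀)x₁ + c, yⱼ = xⱼ + y₂^e}`
# has Zariski dense exponential points (`e ≥ 1`, `r₀ ∉ ℚ`, `c ∈ ℂ`)

Zilber's Exponential-Algebraic Closedness, case ladder (host summit Schanuel, cell `pub-schanuel`,
seat 2, gen 13).  THE FAMILY (`e ≥ 1`, `r₀ ∈ ℝ ∖ ℚ`, `c ∈ ℂ`):

  `W = {x₂ = r₀x₀ + (1/e - r₀)x₁ + c,  y₀ = x₀ + y₂^e,  y₁ = x₁ + y₂^e} ⊆ ℂ³ × ℂ³`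

(fibre polynomial `F(u) = u^{e-1}`, `λ = Σrᵢ = 1/e`, so `λ(1 + deg F) = 1 = deg Aⱼ`: the CRITICAL
size of O54 (a) / O55 (a) with NON-CONSTANT fibres for `e ≥ 2`; `e = 1` is
`ZilberEacDiagonalCriticalDensity`).  The exponential points solve `e^{xⱼ} = xⱼ + e^{e·x₂}` with
`e·x₂ = (er₀)x₀ + (1 - er₀)x₁ + ec` — EXACTLY the diagonal critical system of
`ZilberEacDiagonalCriticalExistence` for the pair `(er₀, ec)`.  So the diagonal-ray solutions exist
for free; reading the coordinates `(x₀, x₁, y₀)` (`y₀ = e^{x₀} ~ m E_k`) instead of `y₂ ~ m^{1/e}`,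
THEOREM N₂ and the genericity of the rotating pairs `(2πik, E_k)`, `E_k = 2πi + Φ(u_k)` (a
translate of `ZilberEacDiagonalCriticalGeneric`'s pairs), give:

**THEOREM (`unprojectedDense_polyFibredGraph_critical_pow`).**  `I(W ∩ Γ_exp) = I(W)` for every
`e ≥ 1`, irrational `r₀` and `c ∈ ℂ`.  Example (`e = 2`, the base of gen 12's `sqrtTwoHalf` with the
fibre that makes it critical): **`sqrtTwoHalfSq_member_dense`**:
`{x₂ = √2x₀ + (1/2 - √2)x₁, y₀ = x₀ + y₂², y₁ = x₁ + y₂²}` ∈ EC(3,2), DENSE.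

HONEST FRAMING: explicit families inside an OPEN cell (equal fibres only: `F₀ = F₁ = u^{e-1}`;
unequal or general fibres at critical size stay open); `EC(3,2)` OPEN; NOT Schanuel's conjecture;
EAC ⇏ SC.
-/

noncomputable section

open Complex MvPolynomial Filter Topology
open Literature.NumberTheory.Transcendental Literature.ModelTheory.Zilber
  Literature.ModelTheory.ExponentialFields

set_option linter.dupNamespace false

namespace Summit.Schanuel.Schanuel.Theorems

section CriticalPow

/-- Translating the second coordinate: `Q(v, P + t)` via `bind₁ (X₀, C P + X₁)`. [folklore] -/
theorem eval_bind₁_translate_snd (Q : MvPolynomial (Fin 2) ℂ) (P v t : ℂ) :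
    eval ![v, t] (bind₁ (![X 0, C P + X 1] : Fin 2 → MvPolynomial (Fin 2) ℂ) Q) =
      eval ![v, P + t] Q := by
  change eval₂Hom (RingHom.id ℂ) _ (bind₁ _ Q) = _
  rw [eval₂Hom_bind₁]
  have e : (fun i => eval₂Hom (RingHom.id ℂ) ![v, t]
      ((![X 0, C P + X 1] : Fin 2 → MvPolynomial (Fin 2) ℂ) i)) = ![v, P + t] := by
    funext i
    fin_cases i <;> simp
  rw [e]
  rfl

/-- The translation of `eval_bind₁_translate_snd` is injective. [folklore] -/
theorem bind₁_translate_snd_ne_zero {Q : MvPolynomial (Fin 2) ℂ} (hQ : Q ≠ 0) (P : ℂ) :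
    bind₁ (![X 0, C P + X 1] : Fin 2 → MvPolynomial (Fin 2) ℂ) Q ≠ 0 := by
  intro h
  apply hQ
  have hinv : bind₁ (![X 0, X 1 - C P] : Fin 2 → MvPolynomial (Fin 2) ℂ)
      (bind₁ (![X 0, C P + X 1] : Fin 2 → MvPolynomial (Fin 2) ℂ) Q) = Q := by
    rw [bind₁_bind₁]
    have e : (fun i => bind₁ (![X 0, X 1 - C P] : Fin 2 → MvPolynomial (Fin 2) ℂ)
        ((![X 0, C P + X 1] : Fin 2 → MvPolynomial (Fin 2) ℂ) i)) = X := by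
      funext i
      fin_cases i <;> simp
    rw [e, bind₁_X_left, AlgHom.id_apply]
  rw [← hinv, h, map_zero]

/-- **The translated rotating pairs `(2πik, P + Φ(u_k))` are Zariski-generic in `ℂ²`.**
(From `diagonalCritical_pairs_generic` by the translation `T ↦ P + T`.) [folklore] -/
theorem diagonalCritical_pairs_generic_translate {r₁ : ℝ} (hr : Irrational r₁) (c : ℂ) {p : ℤ}
    (hp : p ≠ 0) (P : ℂ) (Q : MvPolynomial (Fin 2) ℂ) (hQ : Q ≠ 0) :
    ∃ k : ℕ, exp c * exp (2 * Real.pi * I * (r₁ : ℂ) * (k : ℂ)) ≠ 1 ∧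
      eval ![2 * Real.pi * I * (k : ℂ),
        P + 2 * Real.pi * I * (p : ℂ) * (exp c * exp (2 * Real.pi * I * (r₁ : ℂ) * (k : ℂ))) /
          (1 - exp c * exp (2 * Real.pi * I * (r₁ : ℂ) * (k : ℂ)))] Q ≠ 0 := by
  obtain ⟨k, hgood, hne⟩ := diagonalCritical_pairs_generic hr c hp _
    (bind₁_translate_snd_ne_zero hQ P)
  refine ⟨k, hgood, ?_⟩
  rwa [eval_bind₁_translate_snd] at hne

/-- **THEOREM (Zariski density at critical size with the fibres `yⱼ = xⱼ + y₂^e`).**  For `e ≥ 1`,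
irrational `r₀` and every `c ∈ ℂ` the exponential points of
`W = {x₂ = r₀x₀ + (1/e - r₀)x₁ + c, y₀ = x₀ + y₂^e, y₁ = x₁ + y₂^e}` are Zariski dense. (new)
[cite: MantovaMasser2023, §1 p.5 (the open case dim π(V) = 2 in ℂ³×ℂˣ³)] -/
theorem unprojectedDense_polyFibredGraph_critical_pow (e : ℕ) (he : 1 ≤ e) (r₀ : ℝ)
    (hr : Irrational r₀) (c : ℂ) :
    UnprojectedDense (polyFibredGraph (hyperplanePoly ![r₀, 1 / (e : ℝ) - r₀] c) (fun j => X j)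
      (fun _ => (Polynomial.X ^ (e - 1) : Polynomial ℂ).toMvPolynomial 0)) := by
  classical
  have hπ := Real.pi_pos
  have h2πI : (2 * Real.pi * I : ℂ) ≠ 0 := Complex.two_pi_I_ne_zero
  have he0 : (e : ℝ) ≠ 0 := by exact_mod_cast (show e ≠ 0 by omega)
  have heC : (e : ℂ) ≠ 0 := by exact_mod_cast (show e ≠ 0 by omega)
  -- the scaled data `r' = e r`, `c' = e c`: `e·x₂ = r'₀x₀ + (1 - r'₀)x₁ + c'`
  set r₀' : ℝ := (e : ℝ) * r₀ with hr₀'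
  have hr1' : Irrational (1 - r₀') := by
    rw [hr₀']
    have : Irrational ((e : ℝ) * r₀) := by
      simpa using hr.natCast_mul (show e ≠ 0 by omega)
    simpa using this.ratCast_sub 1
  set c' : ℂ := (e : ℂ) * c with hc'
  -- the rotating numbers and limit values
  set u : ℕ → ℂ := fun k => exp (2 * Real.pi * I * ((1 - r₀' : ℝ) : ℂ) * (k : ℂ)) with hu
  set Ev : ℕ → ℂ := fun k => 2 * Real.pi * I * ((1 : ℤ) : ℂ) +
    2 * Real.pi * I * ((1 : ℤ) : ℂ) * (exp c' * u k) / (1 - exp c' * u k) with hEv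
  set PS : Set (ℂ × ℂ) := {vt | ∃ k : ℕ, exp c' * u k ≠ 1 ∧
    vt = (2 * Real.pi * I * (k : ℂ), Ev k)} with hPS
  have hgen : ∀ Q : MvPolynomial (Fin 2) ℂ, Q ≠ 0 → ∃ vt ∈ PS, eval ![vt.1, vt.2] Q ≠ 0 := by
    intro Q hQ
    obtain ⟨k, hgood, hne⟩ := diagonalCritical_pairs_generic_translate hr1' c' (p := 1) one_ne_zero
      (2 * Real.pi * I * ((1 : ℤ) : ℂ)) Q hQ
    exact ⟨_, ⟨k, hgood, rfl⟩, hne⟩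
  set r : Fin 2 → ℝ := ![r₀, 1 / (e : ℝ) - r₀] with hrdef
  refine unprojectedDense_of_bddLinLin (isIrreducibleClosed_polyFibredGraph _ _ _)
    (by rw [zariskiDim_polyFibredGraph]) ![Sum.inl 0, Sum.inl 1, Sum.inr 0]
    (Wst := 2 * Real.pi * I) h2πI hgen ?_
  rintro _ ⟨k, hgood, rfl⟩
  -- the base point for the scaled diagonal system
  have hden : (1 : ℂ) - exp c' * u k ≠ 0 := by
    intro h; apply hgood; linear_combination -h
  set E : ℂ := 2 * Real.pi * I / (1 - exp c' * u k) with hE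
  have hE0 : E ≠ 0 := div_ne_zero h2πI hden
  have hEeq : E * (1 - exp c' * u k) = 2 * Real.pi * I := by
    rw [hE, div_mul_cancel₀ _ hden]
  set ρs : ℂ × ℂ := (log E, log E + 2 * Real.pi * I * (k : ℂ)) with hρs
  have heE : exp (log E) = E := Complex.exp_log hE0
  have hek : exp (2 * Real.pi * I * (k : ℂ)) = 1 := by
    have := Complex.exp_int_mul_two_pi_mul_I (k : ℤ)
    rw [← this]; congr 1; push_cast; ring
  have hG : exp (c' + (r₀' : ℂ) * ρs.1 + ((1 - r₀' : ℝ) : ℂ) * ρs.2) = exp c' * E * u k := by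
    simp only [hρs, hu]
    rw [show c' + (r₀' : ℂ) * log E + ((1 - r₀' : ℝ) : ℂ) * (log E + 2 * Real.pi * I * (k : ℂ)) =
      c' + log E + 2 * Real.pi * I * ((1 - r₀' : ℝ) : ℂ) * (k : ℂ) by push_cast; ring,
      Complex.exp_add, Complex.exp_add, heE]
  have h0 : exp ρs.1 = 2 * Real.pi * I * ((1 : ℤ) : ℂ) +
      exp (c' + (r₀' : ℂ) * ρs.1 + ((1 - r₀' : ℝ) : ℂ) * ρs.2) := by
    rw [hG]
    simp only [hρs, heE]
    push_cast
    linear_combination hEeq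
  have h1 : exp ρs.2 = 2 * Real.pi * I * ((1 : ℤ) : ℂ) +
      exp (c' + (r₀' : ℂ) * ρs.1 + ((1 - r₀' : ℝ) : ℂ) * ρs.2) := by
    rw [hG]
    simp only [hρs]
    rw [Complex.exp_add, heE, hek]
    push_cast
    linear_combination hEeq
  have hEv : Ev k = E := by
    simp only [hEv, hE]
    push_cast
    field_simp
    ring
  -- the solutions of the SCALED system
  obtain ⟨x, ρ, hρ, hx0, hx1, hsol⟩ :=
    exists_solutions_diagonalCritical r₀' c' (p := 1) one_ne_zero h0 h1
  -- `Σ r'ᵢ xᵢ + c' = e (Σ rᵢ xᵢ + c)`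
  have hscale : ∀ y : Fin 2 → ℂ, (∑ i, ((![r₀', 1 - r₀'] : Fin 2 → ℝ) i : ℂ) * y i) + c' =
      (e : ℂ) * ((∑ i, (r i : ℂ) * y i) + c) := by
    intro y
    rw [Fin.sum_univ_two, Fin.sum_univ_two]
    simp only [hrdef, hr₀', hc', Matrix.cons_val_zero, Matrix.cons_val_one]
    push_cast
    field_simp
  set P : ℕ → Fin 3 ⊕ Fin 3 → ℂ := fun m =>
    pgParam (hyperplanePoly r c) (fun j => X j)
      (fun _ => (Polynomial.X ^ (e - 1) : Polynomial ℂ).toMvPolynomial 0)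
      (x m) (exp (∑ i, (r i : ℂ) * x m i + c)) with hP
  have hρ1 : Tendsto (fun m => (ρ m).1) atTop (𝓝 ρs.1) := (continuous_fst.tendsto _).comp hρ
  have hρ2 : Tendsto (fun m => (ρ m).2) atTop (𝓝 ρs.2) := (continuous_snd.tendsto _).comp hρ
  have hs0 : Tendsto (fun m : ℕ => (((1 / (m : ℝ) : ℝ)) : ℂ)) atTop (𝓝 0) := by
    have h := (continuous_ofReal.tendsto (0 : ℝ)).comp tendsto_one_div_atTop_nhds_zero_nat
    rw [ofReal_zero] at h
    exact h
  have hl0 : Tendsto (fun m : ℕ => (((Real.log m / (m : ℝ) : ℝ)) : ℂ)) atTop (𝓝 0) := by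
    have h := (continuous_ofReal.tendsto (0 : ℝ)).comp
      (tendsto_log_pow_div_natCast_comp (d := fun m => m) tendsto_id 1)
    rw [ofReal_zero] at h
    refine h.congr fun m => ?_
    simp only [Function.comp_apply, pow_one]
  -- the key identity: `exp (Σ rᵢ xᵢ + c) ^ e = exp (Σ r'ᵢ xᵢ + c')`
  have hpow : ∀ y : Fin 2 → ℂ, exp (∑ i, (r i : ℂ) * y i + c) *
      (exp (∑ i, (r i : ℂ) * y i + c)) ^ (e - 1) =
      exp ((∑ i, ((![r₀', 1 - r₀'] : Fin 2 → ℝ) i : ℂ) * y i) + c') := by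
    intro y
    rw [← pow_succ', Nat.sub_add_cancel he, hscale, ← Complex.exp_nat_mul]
  -- the solution property in the shape of `pgParam_hyperplane_mem_expGraph`
  have hsolW : ∀ᶠ m in atTop, ∀ j : Fin 2, exp (x m j) = eval (x m) (X j) +
      exp (∑ i, (r i : ℂ) * x m i + c) *
        ((Polynomial.X ^ (e - 1) : Polynomial ℂ)).eval (exp (∑ i, (r i : ℂ) * x m i + c)) := by
    filter_upwards [hsol] with m hm j
    rw [eval_X, Polynomial.eval_pow, Polynomial.eval_X, hpow, hm j]
  refine ⟨P, fun m => (m : ℝ), ?_, tendsto_natCast_atTop_atTop, ?_, ?_, ?_⟩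
  · filter_upwards [hsolW] with m hm
    exact ⟨pgParam_mem _ _ _ _ _, pgParam_hyperplane_mem_expGraph r c (fun j => X j)
      (fun _ => (Polynomial.X ^ (e - 1) : Polynomial ℂ)) hm⟩
  · -- `x₁ - x₀ → 2πik`
    have hlim : Tendsto (fun m => (ρ m).2 - (ρ m).1) atTop (𝓝 (ρs.2 - ρs.1)) := hρ2.sub hρ1
    have eρ : ρs.2 - ρs.1 = 2 * Real.pi * I * (k : ℂ) := by simp only [hρs]; ring
    rw [eρ] at hlim
    refine hlim.congr fun m => ?_
    have e0 : (Sum.inl 0 : Fin 3 ⊕ Fin 3) = Sum.inl (Fin.castSucc (0 : Fin 2)) := rfl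
    have e1 : (Sum.inl 1 : Fin 3 ⊕ Fin 3) = Sum.inl (Fin.castSucc (1 : Fin 2)) := rfl
    simp only [hP, Matrix.cons_val_one, Matrix.cons_val_zero, e0, e1, pgParam_inl_castSucc,
      hx0 m, hx1 m]
    ring
  · -- `x₀ / m → 2πi`
    have hlim : Tendsto (fun m : ℕ => 2 * Real.pi * I + (((Real.log m / (m : ℝ) : ℝ)) : ℂ) +
        (ρ m).1 * (((1 / (m : ℝ) : ℝ)) : ℂ)) atTop (𝓝 (2 * Real.pi * I + 0 + ρs.1 * 0)) :=
      (tendsto_const_nhds.add hl0).add (hρ1.mul hs0)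
    simp only [add_zero, mul_zero] at hlim
    refine hlim.congr' ?_
    filter_upwards [eventually_ge_atTop 1] with m hm
    have hmC : (m : ℂ) ≠ 0 := by exact_mod_cast (show m ≠ 0 by omega)
    have e0 : (Sum.inl 0 : Fin 3 ⊕ Fin 3) = Sum.inl (Fin.castSucc (0 : Fin 2)) := rfl
    simp only [hP, Matrix.cons_val_zero, e0, pgParam_inl_castSucc, hx0 m]
    push_cast
    field_simp
  · -- `y₀ / m = e^{x₀}/m = e^{ρ₀(m)} → E = Ev k`
    have hlim : Tendsto (fun m => exp (ρ m).1) atTop (𝓝 (exp ρs.1)) :=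
      (Complex.continuous_exp.tendsto _).comp hρ1
    have eρ : exp ρs.1 = Ev k := by rw [hEv]; simp only [hρs, heE]
    rw [eρ] at hlim
    refine hlim.congr' ?_
    filter_upwards [hsolW, eventually_ge_atTop 1] with m hm hm1
    have hmpos : (0 : ℝ) < (m : ℝ) := by exact_mod_cast hm1
    have hmC : (m : ℂ) ≠ 0 := by exact_mod_cast (show m ≠ 0 by omega)
    have hexpL : exp ((Real.log m : ℝ) : ℂ) = (m : ℂ) := by
      rw [← Complex.ofReal_exp, Real.exp_log hmpos]
      push_cast
      rfl
    have hexpP : exp (2 * Real.pi * I * ((1 : ℤ) : ℂ) * (m : ℂ)) = 1 := by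
      have := Complex.exp_int_mul_two_pi_mul_I (m : ℤ)
      rw [← this]; congr 1; push_cast; ring
    have e0 : (Sum.inr 0 : Fin 3 ⊕ Fin 3) = Sum.inr (Fin.castSucc (0 : Fin 2)) := rfl
    have hcoord : P m (Sum.inr 0) = exp (x m 0) := by
      simp only [hP, e0, pgParam_inr, pMulParam_castSucc]
      rw [hm 0, MvPolynomial.eval_toMvPolynomial, Fin.cons_zero]
    rw [show (![Sum.inl 0, Sum.inl 1, Sum.inr 0] : Fin 3 → Fin 3 ⊕ Fin 3) 2 = Sum.inr 0 from rfl,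
      hcoord, hx0 m, Complex.exp_add, Complex.exp_add, hexpP, one_mul, hexpL]
    push_cast
    field_simp

/-- **Certified members at critical size with the fibres `yⱼ = xⱼ + y₂^e`, dense.**  For `e ≥ 1`,
irrational `r₀`, every `c`: all seven hypotheses of `ECCell 3 2`, not linearly split,
`W ∩ Γ_exp ≠ ∅`, `I(W ∩ Γ_exp) = I(W)`. (new)
[cite: MantovaMasser2023, §1 p.5 (the open case dim π(V) = 2 in ℂ³×ℂˣ³)] -/
theorem polyFibredGraph_critical_pow_member_dense (e : ℕ) (he : 1 ≤ e) (r₀ : ℝ)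
    (hr : Irrational r₀) (c : ℂ) :
    (IsIrreducibleClosed ℂ (polyFibredGraph (hyperplanePoly ![r₀, 1 / (e : ℝ) - r₀] c) (fun j => X j)
        (fun _ => (Polynomial.X ^ (e - 1) : Polynomial ℂ).toMvPolynomial 0)) ∧
      (polyFibredGraph (hyperplanePoly ![r₀, 1 / (e : ℝ) - r₀] c) (fun j => X j)
          (fun _ => (Polynomial.X ^ (e - 1) : Polynomial ℂ).toMvPolynomial 0) ∩
            torusLocus ℂ 3).Nonempty ∧
      IsRotund ℂ 3 (polyFibredGraph (hyperplanePoly ![r₀, 1 / (e : ℝ) - r₀] c) (fun j => X j)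
          (fun _ => (Polynomial.X ^ (e - 1) : Polynomial ℂ).toMvPolynomial 0) ∩ torusLocus ℂ 3) ∧
      IsAddFree ℂ 3 (polyFibredGraph (hyperplanePoly ![r₀, 1 / (e : ℝ) - r₀] c) (fun j => X j)
          (fun _ => (Polynomial.X ^ (e - 1) : Polynomial ℂ).toMvPolynomial 0) ∩ torusLocus ℂ 3) ∧
      IsMulFree ℂ 3 (polyFibredGraph (hyperplanePoly ![r₀, 1 / (e : ℝ) - r₀] c) (fun j => X j)
          (fun _ => (Polynomial.X ^ (e - 1) : Polynomial ℂ).toMvPolynomial 0) ∩ torusLocus ℂ 3) ∧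
      zariskiDim ℂ (polyFibredGraph (hyperplanePoly ![r₀, 1 / (e : ℝ) - r₀] c) (fun j => X j)
          (fun _ => (Polynomial.X ^ (e - 1) : Polynomial ℂ).toMvPolynomial 0)) = (3 : ℕ) ∧
      addProjDim ℂ 3 (polyFibredGraph (hyperplanePoly ![r₀, 1 / (e : ℝ) - r₀] c) (fun j => X j)
          (fun _ => (Polynomial.X ^ (e - 1) : Polynomial ℂ).toMvPolynomial 0)) = (2 : ℕ)) ∧
    ¬ IsLinearSplit ℂ 3 (polyFibredGraph (hyperplanePoly ![r₀, 1 / (e : ℝ) - r₀] c) (fun j => X j)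
        (fun _ => (Polynomial.X ^ (e - 1) : Polynomial ℂ).toMvPolynomial 0)) ∧
    (polyFibredGraph (hyperplanePoly ![r₀, 1 / (e : ℝ) - r₀] c) (fun j => X j)
        (fun _ => (Polynomial.X ^ (e - 1) : Polynomial ℂ).toMvPolynomial 0) ∩ expGraph ℂ 3).Nonempty ∧
    UnprojectedDense (polyFibredGraph (hyperplanePoly ![r₀, 1 / (e : ℝ) - r₀] c) (fun j => X j)
        (fun _ => (Polynomial.X ^ (e - 1) : Polynomial ℂ).toMvPolynomial 0)) := by
  have hA : Function.Injective (aeval (fun j : Fin 2 => (X j : MvPolynomial (Fin 2) ℂ)) :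
      MvPolynomial (Fin 2) ℂ →ₐ[ℂ] MvPolynomial (Fin 2) ℂ) := by
    rw [aeval_X_left]; exact fun _ _ h => h
  have hirr : ∃ i : Fin 2, Irrational ((![r₀, 1 / (e : ℝ) - r₀] : Fin 2 → ℝ) i) :=
    ⟨0, by simpa using hr⟩
  have hcell := ecCell_hypotheses_polyFibredGraph_hyperplane ![r₀, 1 / (e : ℝ) - r₀] c
    (fun j => X j) (fun _ => (Polynomial.X ^ (e - 1) : Polynomial ℂ).toMvPolynomial 0) hA hirr
  have hdense := unprojectedDense_polyFibredGraph_critical_pow e he r₀ hr c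
  refine ⟨hcell, not_isLinearSplit_polyFibredGraph _ (fun j => X j) _ (by norm_num) hA, ?_,
    hdense⟩
  obtain ⟨w, hw, -⟩ := hcell.2.1
  exact inter_expGraph_nonempty_of_vanishingIdeal_eq ⟨w, hw⟩ hdense

/-- **A critical example with quadratic fibres is dense** (`e = 2`; the base of gen 12's
`sqrtTwoHalf_member_dense`, whose constant fibres were SLOW, now with the fibre `y₂²` that makes it
critical): `W = {x₂ = √2x₀ + (1/2 - √2)x₁, y₀ = x₀ + y₂², y₁ = x₁ + y₂²}`
(`e^z = z + e^{2√2 z + (1-2√2) w}`, `e^w = w + e^{2√2 z + (1-2√2) w}`): all seven hypotheses of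
`ECCell 3 2`, not linearly split, `W ∩ Γ_exp ≠ ∅`, `I(W ∩ Γ_exp) = I(W)`. (new)
[cite: MantovaMasser2023, §1 p.5 (the open case dim π(V) = 2 in ℂ³×ℂˣ³)] -/
theorem sqrtTwoHalfSq_member_dense :
    (IsIrreducibleClosed ℂ (polyFibredGraph (hyperplanePoly ![Real.sqrt 2, 1 / ((2 : ℕ) : ℝ) - Real.sqrt 2] 0)
        (fun j => X j) (fun _ => (Polynomial.X ^ (2 - 1) : Polynomial ℂ).toMvPolynomial 0)) ∧
      (polyFibredGraph (hyperplanePoly ![Real.sqrt 2, 1 / ((2 : ℕ) : ℝ) - Real.sqrt 2] 0) (fun j => X j)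
          (fun _ => (Polynomial.X ^ (2 - 1) : Polynomial ℂ).toMvPolynomial 0) ∩
            torusLocus ℂ 3).Nonempty ∧
      IsRotund ℂ 3 (polyFibredGraph (hyperplanePoly ![Real.sqrt 2, 1 / ((2 : ℕ) : ℝ) - Real.sqrt 2] 0)
          (fun j => X j) (fun _ => (Polynomial.X ^ (2 - 1) : Polynomial ℂ).toMvPolynomial 0) ∩
            torusLocus ℂ 3) ∧
      IsAddFree ℂ 3 (polyFibredGraph (hyperplanePoly ![Real.sqrt 2, 1 / ((2 : ℕ) : ℝ) - Real.sqrt 2] 0)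
          (fun j => X j) (fun _ => (Polynomial.X ^ (2 - 1) : Polynomial ℂ).toMvPolynomial 0) ∩
            torusLocus ℂ 3) ∧
      IsMulFree ℂ 3 (polyFibredGraph (hyperplanePoly ![Real.sqrt 2, 1 / ((2 : ℕ) : ℝ) - Real.sqrt 2] 0)
          (fun j => X j) (fun _ => (Polynomial.X ^ (2 - 1) : Polynomial ℂ).toMvPolynomial 0) ∩
            torusLocus ℂ 3) ∧
      zariskiDim ℂ (polyFibredGraph (hyperplanePoly ![Real.sqrt 2, 1 / ((2 : ℕ) : ℝ) - Real.sqrt 2] 0)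
          (fun j => X j) (fun _ => (Polynomial.X ^ (2 - 1) : Polynomial ℂ).toMvPolynomial 0)) =
          (3 : ℕ) ∧
      addProjDim ℂ 3 (polyFibredGraph (hyperplanePoly ![Real.sqrt 2, 1 / ((2 : ℕ) : ℝ) - Real.sqrt 2] 0)
          (fun j => X j) (fun _ => (Polynomial.X ^ (2 - 1) : Polynomial ℂ).toMvPolynomial 0)) =
          (2 : ℕ)) ∧
    ¬ IsLinearSplit ℂ 3 (polyFibredGraph (hyperplanePoly ![Real.sqrt 2, 1 / ((2 : ℕ) : ℝ) - Real.sqrt 2] 0)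
        (fun j => X j) (fun _ => (Polynomial.X ^ (2 - 1) : Polynomial ℂ).toMvPolynomial 0)) ∧
    (polyFibredGraph (hyperplanePoly ![Real.sqrt 2, 1 / ((2 : ℕ) : ℝ) - Real.sqrt 2] 0) (fun j => X j)
        (fun _ => (Polynomial.X ^ (2 - 1) : Polynomial ℂ).toMvPolynomial 0) ∩ expGraph ℂ 3).Nonempty ∧
    UnprojectedDense (polyFibredGraph (hyperplanePoly ![Real.sqrt 2, 1 / ((2 : ℕ) : ℝ) - Real.sqrt 2] 0)
        (fun j => X j) (fun _ => (Polynomial.X ^ (2 - 1) : Polynomial ℂ).toMvPolynomial 0)) :=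
  polyFibredGraph_critical_pow_member_dense 2 (by norm_num) (Real.sqrt 2) irrational_sqrt_two 0

end CriticalPow

end Summit.Schanuel.Schanuel.Theorems

end
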